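import Mathlib
import Summits.CriticalPhenomena.SAWScalingLimit.Theorems.SAWDefectDecoherenceDefectDecoherenceTmStarSums
import Summits.CriticalPhenomena.SAWScalingLimit.Theorems.SAWDefectDecoherenceDefectDecoherenceTmExterior
import HarnessLib

/-!
# Covariance under `rot3 v`; admissibility of slit and picture domains
(helper `tm_admissible_picDom` for the stub `stub_telescopingRecursion` of the line
`tip-martingale-depth-induction`, crux `DefectDecoherence`, stmt-CriticalPhenomena-8549)

* Walks transport bijectively along a graph automorphism of `ℍ` (`mapW`), with the same length
  and — when the automorphism acts on centres by a similarity — the same winding (`lw_map`); hence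
  the `ℤ/3` COVARIANCE `TC(ρD, ρa) = conj(ζ²) TC(D, a)` and invariance of `TR` (`TC_rot3`,
  `TR_rot3`).
* SLITTING PRESERVES SIMPLE CONNECTIVITY (`simplyConnected_sdiff`: a chain hanging off `u ∉ Λ`),
  so the slit configuration `(Λ ∖ π, y, z, v)` of a first-entrance prefix is `Admissible`
  (`admissible_sdiff`); the PICTURE DOMAIN `picDom Λ v s (pic v s y z π)` is `Admissible` as well
  (`admissible_picDom`, registered as `tm_admissible_picDom`; its complement is the exterior of
  `B(v,s)` — preconnected by `exterior_preconnected` — plus the near part of the prefix), and it is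
  `rot3 v`-covariant (`picDom_rotPic`).

Sources: H. Duminil-Copin, S. Smirnov, *The connective constant of the honeycomb lattice equals
`√(2+√2)`*, Ann. of Math. 175 (2012) (arXiv:1007.0575), §1–§2 (walks between mid-edges, windings,
Definition 1); the line card `Lines/tip-martingale-depth-induction.md` of the crux.
Deliberately NOT here: the strata bound and the assembly.
-/

noncomputable section

open scoped BigOperators ComplexConjugate Classical
open Literature.Probability.LatticeModels Literature.Probability.RandomPlanarGeometry.SAW
open Literature.Probability.Percolation (PathIn)

namespace Summit.CriticalPhenomena.SAWScalingLimit.Theorems.DefectDecoherence.TipMartingale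

/-! ### Transport of walks along a lattice automorphism acting by a similarity -/

section Transport

variable {D : Finset HexVertex} {a b : Sym2 HexVertex}

/-- Mid-edges transform affinely under an automorphism acting affinely on centres. [folklore] -/
theorem hexMidpoint_map {σ : HexVertex → HexVertex} {κ μ : ℂ}
    (hσ : ∀ y, hexCenter (σ y) = κ * hexCenter y + μ) (e : Sym2 HexVertex) :
    hexMidpoint (e.map σ) = κ * hexMidpoint e + μ := by
  induction e using Sym2.ind with
  | _ p q => simp only [Sym2.map_mk, hexMidpoint_mk, hσ]; ring

/-- **Transport of a walk along a graph automorphism** `σ` of `ℍ`: vertex list `σ ∘ ω`,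
domain `σ(D)`, end mid-edges `σ(a)`, `σ(b)`. [folklore] -/
def mapW (σ : hexGraph ≃g hexGraph) (ω : HexMidEdgeSAW D a b) :
    HexMidEdgeSAW (D.image σ) (a.map σ) (b.map σ) where
  verts := ω.verts.map σ
  subset x hx := by
    obtain ⟨y, hy, rfl⟩ := List.mem_map.1 hx
    exact Finset.mem_image_of_mem _ (ω.subset y hy)
  nodup := ω.nodup.map σ.injective
  isChain := List.isChain_map_of_isChain σ (fun _ _ h => σ.map_rel_iff.2 h) ω.isChain
  head_mem x hx := by
    rw [List.head?_map, Option.map_eq_some_iff] at hx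
    obtain ⟨y, hy, rfl⟩ := hx
    exact Sym2.mem_map.2 ⟨y, ω.head_mem y hy, rfl⟩
  getLast_mem x hx := by
    rw [List.getLast?_map, Option.map_eq_some_iff] at hx
    obtain ⟨y, hy, rfl⟩ := hx
    exact Sym2.mem_map.2 ⟨y, ω.getLast_mem y hy, rfl⟩
  eq_of_nil h := by rw [ω.eq_of_nil (List.map_eq_nil_iff.1 h)]
  edges_nodup h := by
    have hne : ω.verts ≠ [] := fun e => h (by rw [e]; rfl)
    have key : a.map σ :: List.zipWith (fun u w => s(u, w)) (ω.verts.map σ) (ω.verts.map σ).tail ++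
        [b.map σ] = (a :: List.zipWith (fun u w => s(u, w)) ω.verts ω.verts.tail ++ [b]).map
          (Sym2.map σ) := by
      rw [← List.map_tail]
      simp only [List.map_cons, List.map_append, List.map_nil, List.zipWith_map_left,
        List.zipWith_map_right, List.map_zipWith, Sym2.map_mk]
    rw [key]
    exact (ω.edges_nodup hne).map (Sym2.map.injective σ.injective)
  fst_mem := by
    obtain ⟨he, y, hy, hyD⟩ := ω.fst_mem
    exact ⟨(SimpleGraph.Iso.map_mem_edgeSet_iff σ).2 he, σ y, Sym2.mem_map.2 ⟨y, hy, rfl⟩,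
      Finset.mem_image_of_mem _ hyD⟩

/-- Casting a walk along equal domain and end mid-edges. [folklore] -/
def castW {D D' : Finset HexVertex} {a a' b b' : Sym2 HexVertex} (hD : D = D') (ha : a = a')
    (hb : b = b') (ω : HexMidEdgeSAW D a b) : HexMidEdgeSAW D' a' b' := by
  subst hD ha hb; exact ω

/-- `castW` keeps the vertex list. [folklore] -/
@[simp] theorem castW_verts {D D' : Finset HexVertex} {a a' b b' : Sym2 HexVertex} (hD : D = D')
    (ha : a = a') (hb : b = b') (ω : HexMidEdgeSAW D a b) : (castW hD ha hb ω).verts = ω.verts := by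
  subst hD ha hb; rfl

/-- Transport along an automorphism is a bijection of walks. [folklore] -/
theorem mapW_bijective (σ : hexGraph ≃g hexGraph) :
    Function.Bijective (mapW σ : HexMidEdgeSAW D a b → _) := by
  refine ⟨fun ω ω' h => HexMidEdgeSAW.ext ?_, fun ω' => ?_⟩
  · have h' := congrArg HexMidEdgeSAW.verts h
    exact (List.map_injective_iff.2 σ.injective) h'
  · have hid : (⇑σ.symm ∘ ⇑σ) = id := funext fun y => σ.symm_apply_apply y
    have hD : (D.image σ).image σ.symm = D := by
      rw [Finset.image_image, hid, Finset.image_id]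
    have he : ∀ e : Sym2 HexVertex, (e.map σ).map σ.symm = e := fun e => by
      rw [Sym2.map_map, hid, Sym2.map_id, id]
    refine ⟨castW hD (he a) (he b) (mapW σ.symm ω'), HexMidEdgeSAW.ext ?_⟩
    simp [mapW, List.map_map]

/-- **Re-summing over transported walks.** [folklore] -/
theorem sum_mapW {M : Type*} [AddCommMonoid M] (σ : hexGraph ≃g hexGraph)
    {D' : Finset HexVertex} {a' b' : Sym2 HexVertex} (hD : D' = D.image σ) (ha : a' = a.map σ)
    (hb : b' = b.map σ) (f : List HexVertex → M) :
    ∑ ω : HexMidEdgeSAW D' a' b', f ω.verts = ∑ ω : HexMidEdgeSAW D a b, f (ω.verts.map σ) := by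
  subst hD ha hb
  exact (Fintype.sum_bijective (mapW σ) (mapW_bijective σ) (fun ω => f (ω.verts.map σ))
    (fun ω => f ω.verts) fun ω => rfl).symm

/-- List weights are invariant under an automorphism acting by a similarity. [folklore] -/
theorem lw_map {σ : HexVertex → HexVertex} {κ μ : ℂ} (hκ : κ ≠ 0)
    (hσ : ∀ y, hexCenter (σ y) = κ * hexCenter y + μ) (a b : Sym2 HexVertex) (s : ℝ)
    (l : List HexVertex) : lw (a.map σ) (b.map σ) s (l.map σ) = lw a b s l := by
  have key : hexMidpoint (a.map σ) :: (l.map σ).map hexCenter ++ [hexMidpoint (b.map σ)] =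
      (hexMidpoint a :: l.map hexCenter ++ [hexMidpoint b]).map fun z => κ * z + μ := by
    simp [hexMidpoint_map hσ, List.map_map, Function.comp_def, hσ]
  rw [lw, lw, key, winding_map_affine hκ, List.length_map]

end Transport

/-! ### Covariance of the star sums under `rot3 v` -/

section Covariance

variable (v : HexVertex) {D : Finset HexVertex} {a : Sym2 HexVertex} {E : List HexVertex → Prop}

/-- The star of `v` in a rotated domain is the rotated star. [folklore] -/
theorem star_image_rot3 (D : Finset HexVertex) :
    star (D.image (rot3 v)) v = (star D v).image (rot3 v) := by
  ext t
  simp only [star, Finset.mem_filter, Finset.mem_image]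
  constructor
  · rintro ⟨⟨t', ht', rfl⟩, hadj⟩
    refine ⟨t', ⟨ht', ?_⟩, rfl⟩
    rw [← rot3_adj_iff v, rot3_self]; exact hadj
  · rintro ⟨t', ⟨ht', hadj⟩, rfl⟩
    refine ⟨⟨t', ht', rfl⟩, ?_⟩
    have := (rot3_adj_iff v v t').2 hadj
    rwa [rot3_self] at this

/-- `rot3 v` is injective. [folklore] -/
theorem rot3_injective : Function.Injective (rot3 v) := (rot3Iso v).injective

/-- **`ℤ/3` covariance of the defect-type sums**: rotating the domain and the root by `rot3 v`
multiplies `TC` by `conj(ζ²)` (walks transport bijectively with the same length and winding,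
and `mid{v, ρt} - c_v = ζ² (mid{v,t} - c_v)`). [folklore] -/
theorem TC_rot3 (hE : ∀ l : List HexVertex, E (l.map (rot3 v)) ↔ E l) (D : Finset HexVertex)
    (a : Sym2 HexVertex) :
    TC (D.image (rot3 v)) (a.map (rot3 v)) v E = (starRingEnd ℂ) (triZeta ^ 2) * TC D a v E := by
  rw [TC, TC, star_image_rot3, Finset.sum_image fun x _ y _ h => rot3_injective v h,
    Finset.mul_sum]
  refine Finset.sum_congr rfl fun t _ => ?_
  have hb : s(v, rot3 v t) = (s(v, t)).map (rot3Iso v) := by simp [rot3_self]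
  have hD : D.image (rot3 v) = D.image (rot3Iso v) := rfl
  have ha : a.map (rot3 v) = a.map (rot3Iso v) := rfl
  simp_rw [weight_eq_lw]
  rw [sum_mapW (rot3Iso v) hD ha hb fun l => if E l then lw (a.map (rot3 v)) s(v, rot3 v t) (5 / 8) l
    else 0]
  have hmid : hexMidpoint s(v, rot3 v t) - hexCenter v = triZeta ^ 2 * (hexMidpoint s(v, t) -
      hexCenter v) := by
    rw [hexMidpoint_mk, hexMidpoint_mk, hexCenter_rot3]; ring
  rw [hmid, map_mul, mul_assoc]
  congr 2
  refine Finset.sum_congr rfl fun ω _ => ?_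
  simp only [coe_rot3Iso, hE]
  split_ifs
  · rw [show s(v, rot3 v t) = (s(v, t)).map (rot3 v) by simp [rot3_self],
      lw_map (pow_ne_zero 2 (fun h => by simpa [h] using norm_triZeta_sq)) (hexCenter_rot3 v)]
  · rfl

/-- **`ℤ/3` invariance of the mass-type sums.** [folklore] -/
theorem TR_rot3 (hE : ∀ l : List HexVertex, E (l.map (rot3 v)) ↔ E l) (D : Finset HexVertex)
    (a : Sym2 HexVertex) :
    TR (D.image (rot3 v)) (a.map (rot3 v)) v E = TR D a v E := by
  rw [TR, TR, star_image_rot3, Finset.sum_image fun x _ y _ h => rot3_injective v h]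
  refine Finset.sum_congr rfl fun t _ => ?_
  have hb : s(v, rot3 v t) = (s(v, t)).map (rot3Iso v) := by simp [rot3_self]
  have hD : D.image (rot3 v) = D.image (rot3Iso v) := rfl
  have ha : a.map (rot3 v) = a.map (rot3Iso v) := rfl
  simp only [HexMidEdgeSAW.length]
  rw [sum_mapW (rot3Iso v) hD ha hb fun l => if E l then xc ^ l.length else 0]
  simp only [coe_rot3Iso, hE, List.length_map]

end Covariance

section Connectivity

/-- A walk of an induced subgraph is a path inside the inducing set. [folklore] -/
theorem pathIn_of_walk {S : Set HexVertex} :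
    ∀ {p q : S} (_ : (hexGraph.induce S).Walk p q), PathIn hexGraph S p.1 q.1
  | p, _, .nil => PathIn.refl p.2
  | p, _, .cons (v := r) h W =>
    (PathIn.of_adj p.2 r.2 (SimpleGraph.induce_adj.1 h)).trans (pathIn_of_walk W)

/-- Preconnectedness of an induced subgraph gives paths inside the set. [folklore] -/
theorem pathIn_of_preconnected {S : Set HexVertex} (h : (hexGraph.induce S).Preconnected)
    {x y : HexVertex} (hx : x ∈ S) (hy : y ∈ S) : PathIn hexGraph S x y := by
  obtain ⟨W⟩ := h ⟨x, hx⟩ ⟨y, hy⟩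
  exact pathIn_of_walk W

/-- **Attaching**: a superset `S'` of a preconnected set `S` all of whose points are joined to `S`
inside `S'` is preconnected. [folklore] -/
theorem preconnected_of_attached {S S' : Set HexVertex} (hS : (hexGraph.induce S).Preconnected)
    (hSS' : S ⊆ S') (hatt : ∀ x ∈ S', ∃ y ∈ S, PathIn hexGraph S' x y) :
    (hexGraph.induce S').Preconnected := by
  refine preconnected_induce_of_forall_pathIn fun x hx y hy => ?_
  obtain ⟨x', hx', px⟩ := hatt x hx
  obtain ⟨y', hy', py⟩ := hatt y hy
  exact (px.trans ((pathIn_of_preconnected hS hx' hy').mono hSS')).trans py.symm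

/-- Along a chain of adjacent vertices inside `S'`, the head is joined to every member. [folklore] -/
theorem pathIn_of_isChain {S' : Set HexVertex} : ∀ {x : HexVertex} {l : List HexVertex},
    (x :: l).IsChain hexGraph.Adj → (∀ y ∈ x :: l, y ∈ S') → ∀ y ∈ x :: l, PathIn hexGraph S' x y
  | x, [], _, hS, y, hy => by
    rw [List.mem_singleton] at hy; subst hy
    exact PathIn.refl (hS _ List.mem_cons_self)
  | x, z :: l, hc, hS, y, hy => by
    rcases List.mem_cons.1 hy with rfl | hy
    · exact PathIn.refl (hS _ List.mem_cons_self)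
    · have hc' := List.isChain_cons_cons.1 hc
      exact (PathIn.of_adj (hS _ List.mem_cons_self) (hS _ (List.mem_cons_of_mem _
        List.mem_cons_self)) hc'.1).trans (pathIn_of_isChain hc'.2
          (fun y hy => hS y (List.mem_cons_of_mem _ hy)) y hy)

end Connectivity

/-! ### Admissibility of slit domains and of picture domains -/

section Admissibility

variable {Λ : Finset HexVertex} {u w v : HexVertex} {R : ℝ}

/-- Unfolding `Admissible`. [folklore] -/
theorem admissible_iff (Λ : Finset HexVertex) (u w v : HexVertex) (R : ℝ) :
    Admissible Λ u w v R ↔ hexDomainSimplyConnected Λ ∧ hexGraph.Adj u w ∧ u ∉ Λ ∧ w ∈ Λ ∧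
      1 ≤ R ∧ Deep Λ v R := Iff.rfl

/-- A walk from the boundary root `s(u,w)` continues the dart `u → w`: `u :: verts` is a chain.
[folklore] -/
theorem isChain_cons_verts {b : Sym2 HexVertex} (hadj : hexGraph.Adj u w) (hu : u ∉ Λ)
    (γ : HexMidEdgeSAW Λ s(u, w) b) : (u :: γ.verts).IsChain hexGraph.Adj := by
  rw [List.isChain_cons]
  refine ⟨fun y hy => ?_, γ.isChain⟩
  rcases Sym2.mem_iff.1 (γ.head_mem y hy) with rfl | rfl
  · exact absurd (γ.subset _ (List.mem_of_mem_head? hy)) hu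
  · exact hadj

/-- **Slitting preserves simple connectivity**: removing from `Λ` a chain attached to a vertex
`u ∉ Λ` keeps the complement connected. [folklore] -/
theorem simplyConnected_sdiff (hΛ : hexDomainSimplyConnected Λ) (hu : u ∉ Λ)
    {l : List HexVertex} (hc : (u :: l).IsChain hexGraph.Adj) :
    hexDomainSimplyConnected (Λ \ l.toFinset) := by
  unfold hexDomainSimplyConnected at *
  have hsub : ((↑Λ : Set HexVertex)ᶜ) ⊆ (↑(Λ \ l.toFinset) : Set HexVertex)ᶜ := fun x hx => by
    simp only [Set.mem_compl_iff, Finset.mem_coe, Finset.mem_sdiff] at hx ⊢; tauto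
  refine preconnected_of_attached hΛ hsub fun x hx => ?_
  by_cases hxΛ : x ∈ Λ
  · have hxl : x ∈ l := by
      simp only [Set.mem_compl_iff, Finset.mem_coe, Finset.mem_sdiff, List.mem_toFinset] at hx
      tauto
    refine ⟨u, hu, (pathIn_of_isChain hc (fun y hy => ?_) x (List.mem_cons_of_mem _ hxl)).symm⟩
    rcases List.mem_cons.1 hy with rfl | hy
    · exact hsub hu
    · simp [hy]
  · exact ⟨x, hxΛ, PathIn.refl hx⟩

/-- **The slit configuration of a first-entrance prefix is admissible** at the entrance depth.
[folklore] -/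
theorem admissible_sdiff (hA : Admissible Λ u w v R) {ρ : ℝ} (hρ : 1 ≤ ρ) (hρR : ρ ≤ R)
    {y z : HexVertex} {π : HexMidEdgeSAW Λ s(u, w) s(y, z)} (hP : IsPrefix v ρ y z π) :
    Admissible (Λ \ π.verts.toFinset) y z v ρ := by
  obtain ⟨hsc, hadj, hu, -, -, hdeep⟩ := hA
  obtain ⟨hy, hyz, hz, hout⟩ := (isPrefix_iff π).1 hP
  have hzπ : ∀ q, dist (hexCenter q) (hexCenter v) ≤ ρ → q ∉ π.verts.toFinset := fun q hq h =>
    absurd (hout q (List.mem_toFinset.1 h)) (not_lt.2 hq)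
  refine (admissible_iff _ _ _ _ _).2 ⟨simplyConnected_sdiff hsc hu (isChain_cons_verts hadj hu π),
    hyz, fun h => (Finset.mem_sdiff.1 h).2 (List.mem_toFinset.2 (List.mem_of_getLast? hy)),
    Finset.mem_sdiff.2 ⟨hdeep z (hz.trans hρR), hzπ z hz⟩, hρ, fun q hq =>
    Finset.mem_sdiff.2 ⟨hdeep q (hq.trans hρR), hzπ q hq⟩⟩

/-- Membership in a picture domain of a prefix. [folklore] -/
theorem mem_picDom_pic {s r : ℝ} {y z q : HexVertex} {b : Sym2 HexVertex}
    (π : HexMidEdgeSAW Λ b s(y, z)) :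
    q ∈ picDom Λ v s (pic v r y z π) ↔ (q ∈ Λ ∧ dist (hexCenter q) (hexCenter v) ≤ s) ∧
      ¬ (q ∈ π.verts ∧ dist (hexCenter q) (hexCenter v) ≤ r) := by
  simp [picDom, pic, ball, Finset.mem_sdiff, Finset.mem_filter]

/-- A picture domain of a prefix lies inside the slit domain. [folklore] -/
theorem picDom_subset {s : ℝ} {y z : HexVertex} {b : Sym2 HexVertex}
    (π : HexMidEdgeSAW Λ b s(y, z)) : picDom Λ v s (pic v s y z π) ⊆ Λ \ π.verts.toFinset := by
  intro q hq
  rw [mem_picDom_pic] at hq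
  exact Finset.mem_sdiff.2 ⟨hq.1.1, fun h => hq.2 ⟨List.mem_toFinset.1 h, hq.1.2⟩⟩

/-- **The picture-domain configuration of a first-entrance prefix is admissible** at the
entrance depth (`r ≤ s ≤ R`): its complement consists of the far region `{dist > s}`
(preconnected, `exterior_preconnected`) with the near part of the prefix hanging off it.
[folklore] -/
theorem admissible_picDom (hA : Admissible Λ u w v R) {r s : ℝ} (hr : 1 ≤ r) (hrs : r ≤ s)
    (hsR : s ≤ R) {y z : HexVertex} {π : HexMidEdgeSAW Λ s(u, w) s(y, z)}
    (hP : IsPrefix v r y z π) : Admissible (picDom Λ v s (pic v s y z π)) y z v r := by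
  obtain ⟨-, hadj, hu, -, -, hdeep⟩ := hA
  obtain ⟨hy, hyz, hz, hout⟩ := (isPrefix_iff π).1 hP
  have hfar : ∀ q, q ∉ Λ → s < dist (hexCenter q) (hexCenter v) := fun q hq =>
    lt_of_not_ge fun h => hq (hdeep q (h.trans hsR))
  refine (admissible_iff _ _ _ _ _).2 ⟨?_, hyz, fun h => ?_, ?_, hr, fun q hq => ?_⟩
  · -- simple connectivity
    unfold hexDomainSimplyConnected
    have hsub : {x | s < dist (hexCenter x) (hexCenter v)} ⊆
        (↑(picDom Λ v s (pic v s y z π)) : Set HexVertex)ᶜ := fun q hq h => by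
      rw [Finset.mem_coe, mem_picDom_pic] at h
      exact absurd h.1.2 (not_le.2 hq)
    refine preconnected_of_attached (exterior_preconnected v s) hsub fun q hq => ?_
    rw [Set.mem_compl_iff, Finset.mem_coe, mem_picDom_pic] at hq
    by_cases hqs : s < dist (hexCenter q) (hexCenter v)
    · exact ⟨q, hqs, PathIn.refl (hsub hqs)⟩
    · have hqπ : q ∈ π.verts := by
        by_contra hqπ
        exact hq ⟨⟨by_contra fun hqΛ => hqs (hfar q hqΛ), le_of_not_gt hqs⟩, fun h => hqπ h.1⟩
      refine ⟨u, hfar u hu, (pathIn_of_isChain (isChain_cons_verts hadj hu π) (fun x hx => ?_) q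
        (List.mem_cons_of_mem _ hqπ)).symm⟩
      rcases List.mem_cons.1 hx with rfl | hx
      · exact hsub (hfar _ hu)
      · rw [Set.mem_compl_iff, Finset.mem_coe, mem_picDom_pic]
        exact fun h => h.2 ⟨hx, h.1.2⟩
  · rw [mem_picDom_pic] at h
    exact h.2 ⟨List.mem_of_getLast? hy, h.1.2⟩
  · rw [mem_picDom_pic]
    exact ⟨⟨hdeep z (hz.trans (hrs.trans hsR)), hz.trans hrs⟩, fun h => absurd (hout z h.1)
      (not_lt.2 hz)⟩
  · rw [mem_picDom_pic]
    exact ⟨⟨hdeep q (hq.trans (hrs.trans hsR)), hq.trans hrs⟩, fun h => absurd (hout q h.1)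
      (not_lt.2 hq)⟩

/-- Under depth `R ≥ s` the ball `B(v,s) ∩ Λ` is the full lattice ball, hence `rot3`-invariant.
[folklore] -/
theorem ball_image_rot3 (hdeep : Deep Λ v R) {s : ℝ} (hs : s ≤ R) :
    (ball Λ v s).image (rot3 v) = ball Λ v s := by
  ext t
  simp only [ball, Finset.mem_image, Finset.mem_filter]
  constructor
  · rintro ⟨t', ⟨-, ht'⟩, rfl⟩
    rw [dist_rot3]
    exact ⟨hdeep _ (((dist_rot3 v t').le.trans ht').trans hs), ht'⟩
  · rintro ⟨-, ht⟩
    refine ⟨rot3 v (rot3 v t), ⟨hdeep _ ?_, ?_⟩, rot3_rot3_rot3 v t⟩ <;>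
      rw [dist_rot3, dist_rot3] <;> linarith

/-- The picture domain of a rotated picture is the rotated picture domain. [folklore] -/
theorem picDom_rotPic (hdeep : Deep Λ v R) {s : ℝ} (hs : s ≤ R) (P : Picture) :
    picDom Λ v s (rotPic v P) = (picDom Λ v s P).image (rot3 v) := by
  rw [picDom, picDom, rotPic, Finset.image_sdiff _ _ (rot3_injective v), ball_image_rot3 hdeep hs]

end Admissibility

/-- **Registered helper `tm_admissible_picDom`**: picture-domain configurations of first-entrance
prefixes are admissible at the entrance depth. [folklore] -/
theorem tm_admissible_picDom : ∀ (Λ : Finset HexVertex) (u w v : HexVertex) (R r s : ℝ)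
    (y z : HexVertex) (π : HexMidEdgeSAW Λ s(u, w) s(y, z)), Admissible Λ u w v R → 1 ≤ r → r ≤ s →
    s ≤ R → IsPrefix v r y z π → Admissible (picDom Λ v s (pic v s y z π)) y z v r :=
  fun _ _ _ _ _ _ _ _ _ _ hA hr hrs hsR hP => admissible_picDom hA hr hrs hsR hP

end Summit.CriticalPhenomena.SAWScalingLimit.Theorems.DefectDecoherence.TipMartingale

end
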